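import Summits.AtomisticToContinuum.BoseEinsteinCondensation.Theorems.BECHeatBathGapSquareSummableInfluencePairFactorisation
import Literature.MathematicalPhysics.QuantumManyBody.GroundState
import HarnessLib

/-!
# Route `BECHeatBathGap`, crux `SquareSummableInfluence` (stmt-AtomisticToContinuum-14368), line `registered`:
# Bose symmetry among the bath labels — A2 at ONE tolerance gives the single-particle influence at EVERY tolerance

Supports (does not close) stmt-AtomisticToContinuum-14368 (lead c6). The Mayers junction
(`someNearMinimiserCondenses_of_singleInfluence_of_alignment`, this line) consumes `SingleParticleInfluence`: at low
density, for every `ε > 0`, eventually in `N`, the least-squares influence `LS_i` of EACH bath particle is `≤ ε`. This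
file derives it from the registered leaf of card A2 (skeleton v4, `stub_leastSquaresInfluence`: `∑_i LS_i ≤ ε₁` at low
density `ρ < ρ₀(ε₁)`):

* `leastSquares_eq_of_swap` — relabelling two bath particles leaves the least-squares influence invariant when the bath
  state and the `(N+1)`-body state are symmetric under that transposition: `LS_i = LS_j` (measure-preserving relabelling
  of the box, `setLIntegral_boxN_comp_perm`);
* `singleParticleInfluence_of_leastSquaresForm` — hence `N · LS_i = ∑_j LS_j ≤ ε₁`, so `LS_i ≤ ε₁/N ≤ ε` eventually: the
  v4 leaf at the single tolerance `ε₁ = 1` implies `SingleParticleInfluence` (with `ρ₀ = ρ₀(1)`, uniformly in `ε`).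

`[folklore]`.
-/

noncomputable section

open MeasureTheory Filter Function
open scoped ENNReal NNReal Topology ComplexConjugate

namespace Summit.AtomisticToContinuum.BoseEinsteinCondensation.Theorems.SquareSummableInfluence

open Literature.MathematicalPhysics.QuantumManyBody.BoseGas

/-- Transposing two bath slots, read on the tail: `tail (Z ∘ swap(succ i, succ j)) = (tail Z) ∘ swap(i, j)`.
[folklore] -/
theorem vecTail_comp_swap_succ {N : ℕ} (i j : Fin N) (Z : Config (N + 1)) :
    Matrix.vecTail (Z ∘ Equiv.swap (Fin.succ i) (Fin.succ j)) = Matrix.vecTail Z ∘ Equiv.swap i j := by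
  funext k
  simp only [Matrix.vecTail, Function.comp_apply]
  by_cases hki : k = i
  · subst hki
    simp [Equiv.swap_apply_left]
  · by_cases hkj : k = j
    · subst hkj
      simp [Equiv.swap_apply_right]
    · rw [Equiv.swap_apply_of_ne_of_ne (fun h => hki (Fin.succ_injective _ h))
        (fun h => hkj (Fin.succ_injective _ h)), Equiv.swap_apply_of_ne_of_ne hki hkj]

/-- **Relabelling two bath particles leaves the least-squares influence invariant.** If the bath state `Θ` is
symmetric under the transposition `swap(i, j)` of two bath labels and the `(N+1)`-body state `Ψ` under the corresponding
transposition `swap(succ i, succ j)` (both hold for Bose-symmetric states), then `LS_i(Θ, Ψ) = LS_j(Θ, Ψ)`: the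
least-squares predictor of slot `i` evaluated at the relabelled configuration is the predictor of slot `j`, and the box
integral is relabelling invariant (`setLIntegral_boxN_comp_perm`). [folklore] -/
theorem leastSquares_eq_of_swap :
    ∀ (N : ℕ) (L : ℝ) (Θ : Config N → ℂ) (Ψ : Config (N + 1) → ℂ), Measurable Θ → Measurable Ψ →
      ∀ (i j : Fin N), (∀ X : Config N, Θ (X ∘ Equiv.swap i j) = Θ X) →
      (∀ Z : Config (N + 1), Ψ (Z ∘ Equiv.swap (Fin.succ i) (Fin.succ j)) = Ψ Z) →
    (∫⁻ Z in boxN (N + 1) L, (‖Ψ Z -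
        ((∫ x in box L, conj (Θ (Matrix.vecTail (Function.update Z (Fin.succ i) x))) *
            Ψ (Function.update Z (Fin.succ i) x)) /
          (((∫⁻ x in box L, (‖Θ (Matrix.vecTail (Function.update Z (Fin.succ i) x))‖₊ : ℝ≥0∞) ^ 2).toReal
            : ℝ) : ℂ)) *
          Θ (Matrix.vecTail Z)‖₊ : ℝ≥0∞) ^ 2) =
      ∫⁻ Z in boxN (N + 1) L, (‖Ψ Z -
        ((∫ x in box L, conj (Θ (Matrix.vecTail (Function.update Z (Fin.succ j) x))) *
            Ψ (Function.update Z (Fin.succ j) x)) /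
          (((∫⁻ x in box L, (‖Θ (Matrix.vecTail (Function.update Z (Fin.succ j) x))‖₊ : ℝ≥0∞) ^ 2).toReal
            : ℝ) : ℂ)) *
          Θ (Matrix.vecTail Z)‖₊ : ℝ≥0∞) ^ 2 := by
  intro N L Θ Ψ hΘ hΨ i j hΘs hΨs
  set g : Equiv.Perm (Fin (N + 1)) := Equiv.swap (Fin.succ i) (Fin.succ j) with hg
  -- the integrand of slot `k`
  set F : Fin N → Config (N + 1) → ℝ≥0∞ := fun k Z => (‖Ψ Z -
      ((∫ x in box L, conj (Θ (Matrix.vecTail (Function.update Z (Fin.succ k) x))) *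
          Ψ (Function.update Z (Fin.succ k) x)) /
        (((∫⁻ x in box L, (‖Θ (Matrix.vecTail (Function.update Z (Fin.succ k) x))‖₊ : ℝ≥0∞) ^ 2).toReal
          : ℝ) : ℂ)) *
        Θ (Matrix.vecTail Z)‖₊ : ℝ≥0∞) ^ 2 with hF
  change ∫⁻ Z in boxN (N + 1) L, F i Z = ∫⁻ Z in boxN (N + 1) L, F j Z
  -- measurability of `F i`
  have hU : Measurable fun p : Config (N + 1) × Space => Function.update p.1 (Fin.succ i) p.2 :=
    measurable_update'
  have hθtm : Measurable fun p : Config (N + 1) × Space =>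
      Θ (Matrix.vecTail (Function.update p.1 (Fin.succ i) p.2)) := hΘ.comp (measurable_vecTail.comp hU)
  have hψtm : Measurable fun p : Config (N + 1) × Space => Ψ (Function.update p.1 (Fin.succ i) p.2) :=
    hΨ.comp hU
  have hom : Measurable fun Z : Config (N + 1) => ∫ x in box L,
      conj (Θ (Matrix.vecTail (Function.update Z (Fin.succ i) x))) * Ψ (Function.update Z (Fin.succ i) x) :=
    (((Complex.continuous_conj.measurable.comp hθtm).mul hψtm).stronglyMeasurable.integral_prod_right'
      (ν := (volume : Measure Space).restrict (box L))).measurable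
  have hmm : Measurable fun Z : Config (N + 1) => ∫⁻ x in box L,
      (‖Θ (Matrix.vecTail (Function.update Z (Fin.succ i) x))‖₊ : ℝ≥0∞) ^ 2 :=
    (hθtm.nnnorm.coe_nnreal_ennreal.pow_const 2).lintegral_prod_right'
  have hFim : Measurable (F i) :=
    (hΨ.sub ((hom.div (Complex.measurable_ofReal.comp hmm.ennreal_toReal)).mul
      (hΘ.comp measurable_vecTail))).nnnorm.coe_nnreal_ennreal.pow_const 2
  -- the relabelled slot-`i` integrand is the slot-`j` integrand
  have hupd : ∀ (Z : Config (N + 1)) (x : Space),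
      Function.update (Z ∘ g) (Fin.succ i) x = Function.update Z (Fin.succ j) x ∘ g := by
    intro Z x
    rw [Function.update_comp_equiv Z g (Fin.succ j) x]
    simp [hg, Equiv.swap_apply_right]
  have hkey : ∀ Z, F i (Z ∘ g) = F j Z := by
    intro Z
    simp only [hF]
    have h1 : Ψ (Z ∘ g) = Ψ Z := hΨs Z
    have h2 : Θ (Matrix.vecTail (Z ∘ g)) = Θ (Matrix.vecTail Z) := by
      rw [hg, vecTail_comp_swap_succ, hΘs]
    have h3 : ∀ x, Θ (Matrix.vecTail (Function.update (Z ∘ g) (Fin.succ i) x)) =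
        Θ (Matrix.vecTail (Function.update Z (Fin.succ j) x)) := fun x => by
      rw [hupd, hg, vecTail_comp_swap_succ, hΘs]
    have h4 : ∀ x, Ψ (Function.update (Z ∘ g) (Fin.succ i) x) = Ψ (Function.update Z (Fin.succ j) x) :=
      fun x => by rw [hupd, hΨs]
    simp only [h1, h2, h3, h4]
  calc ∫⁻ Z in boxN (N + 1) L, F i Z = ∫⁻ Z in boxN (N + 1) L, F i (Z ∘ g) :=
        (setLIntegral_boxN_comp_perm L g hFim).symm
    _ = ∫⁻ Z in boxN (N + 1) L, F j Z := lintegral_congr fun Z => hkey Z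

/-- **`SingleParticleInfluence` from the least-squares leaf of card A2 at one tolerance.** If (skeleton v4's
`stub_leastSquaresInfluence`, verbatim as hypothesis) for every `ε₁ > 0` at low density `ρ < ρ₀(ε₁)` and eventually in
`N` every `N`-body ground state `Θ₀` admits an `(N+1)`-body ground state `Ψ₀` with `∑_i LS_i ≤ ε₁`, then — using only
`ε₁ = 1` — for `ρ < ρ₀(1)` and EVERY `ε > 0`, eventually in `N`, `LS_i ≤ ε` for each bath label `i`: by Bose symmetry of
both ground states the `N` summands are equal (`leastSquares_eq_of_swap`), so `LS_i ≤ 1/N`. [folklore] -/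
theorem singleParticleInfluence_of_leastSquaresForm :
    (∀ v : ℝ → ℝ≥0∞, IsRepulsiveFiniteRange v → ∀ ε : ℝ, 0 < ε →
      ∃ ρ₀ : ℝ, 0 < ρ₀ ∧ ∀ ρ : ℝ, 0 < ρ → ρ < ρ₀ → ∀ᶠ N : ℕ in atTop,
        ∀ Θ₀ : Config N → ℂ, IsGroundState v (sideLength ρ (N + 1)) Θ₀ →
          ∃ Ψ₀ : Config (N + 1) → ℂ, IsGroundState v (sideLength ρ (N + 1)) Ψ₀ ∧
            (∑ i : Fin N, ∫⁻ Z in boxN (N + 1) (sideLength ρ (N + 1)),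
              (‖Ψ₀ Z -
                ((∫ x in box (sideLength ρ (N + 1)), conj (Θ₀ (Matrix.vecTail (Function.update Z (Fin.succ i) x))) *
                  Ψ₀ (Function.update Z (Fin.succ i) x)) /
                (((∫⁻ x in box (sideLength ρ (N + 1)),
                    (‖Θ₀ (Matrix.vecTail (Function.update Z (Fin.succ i) x))‖₊ : ℝ≥0∞) ^ 2).toReal : ℝ) : ℂ)) *
                  Θ₀ (Matrix.vecTail Z)‖₊ : ℝ≥0∞) ^ 2) ≤ ENNReal.ofReal ε) →
    (∀ v : ℝ → ℝ≥0∞, IsRepulsiveFiniteRange v →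
      ∃ ρ₀ : ℝ, 0 < ρ₀ ∧ ∀ ρ : ℝ, 0 < ρ → ρ < ρ₀ → ∀ ε : ℝ, 0 < ε → ∀ᶠ N : ℕ in atTop,
        ∀ Θ₀ : Config N → ℂ, IsGroundState v (sideLength ρ (N + 1)) Θ₀ →
          ∃ Ψ₀ : Config (N + 1) → ℂ, IsGroundState v (sideLength ρ (N + 1)) Ψ₀ ∧
            ∀ i : Fin N, (∫⁻ Z in boxN (N + 1) (sideLength ρ (N + 1)),
              (‖Ψ₀ Z -
                ((∫ x in box (sideLength ρ (N + 1)), conj (Θ₀ (Matrix.vecTail (Function.update Z (Fin.succ i) x))) *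
                  Ψ₀ (Function.update Z (Fin.succ i) x)) /
                (((∫⁻ x in box (sideLength ρ (N + 1)),
                    (‖Θ₀ (Matrix.vecTail (Function.update Z (Fin.succ i) x))‖₊ : ℝ≥0∞) ^ 2).toReal : ℝ) : ℂ)) *
                  Θ₀ (Matrix.vecTail Z)‖₊ : ℝ≥0∞) ^ 2) ≤ ENNReal.ofReal ε) := by
  intro h v hv
  obtain ⟨ρ₀, hρ₀, H⟩ := h v hv 1 one_pos
  refine ⟨ρ₀, hρ₀, fun ρ hρ hρlt ε hε => ?_⟩
  filter_upwards [H ρ hρ hρlt, eventually_ge_atTop ⌈1 / ε⌉₊] with N hN hNge Θ₀ hΘ₀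
  obtain ⟨Ψ₀, hΨ₀, hsum⟩ := hN Θ₀ hΘ₀
  refine ⟨Ψ₀, hΨ₀, fun i => ?_⟩
  set L := sideLength ρ (N + 1) with hL
  set LS : Fin N → ℝ≥0∞ := fun k => ∫⁻ Z in boxN (N + 1) L, (‖Ψ₀ Z -
      ((∫ x in box L, conj (Θ₀ (Matrix.vecTail (Function.update Z (Fin.succ k) x))) *
          Ψ₀ (Function.update Z (Fin.succ k) x)) /
        (((∫⁻ x in box L, (‖Θ₀ (Matrix.vecTail (Function.update Z (Fin.succ k) x))‖₊ : ℝ≥0∞) ^ 2).toReal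
          : ℝ) : ℂ)) *
        Θ₀ (Matrix.vecTail Z)‖₊ : ℝ≥0∞) ^ 2 with hLS
  change LS i ≤ ENNReal.ofReal ε
  change (∑ k : Fin N, LS k) ≤ ENNReal.ofReal 1 at hsum
  -- all summands are equal by Bose symmetry
  have heq : ∀ k, LS k = LS i := fun k =>
    leastSquares_eq_of_swap N L Θ₀ Ψ₀ hΘ₀.measurable hΨ₀.measurable k i (fun X => hΘ₀.symm _ X)
      (fun Z => hΨ₀.symm _ Z)
  have hNLS : (N : ℝ≥0∞) * LS i ≤ ENNReal.ofReal 1 := by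
    calc (N : ℝ≥0∞) * LS i = ∑ k : Fin N, LS k := by
          simp only [heq, Finset.sum_const, Finset.card_univ, Fintype.card_fin, nsmul_eq_mul]
      _ ≤ ENNReal.ofReal 1 := hsum
  -- `N ≥ ⌈1/ε⌉` and `N ≥ 1` (the bath label `i` exists)
  have hNpos : 0 < N := Fin.pos i
  have hNε : (1 : ℝ) ≤ ε * N := by
    have h1 : 1 / ε ≤ (N : ℝ) := (Nat.le_ceil _).trans (by exact_mod_cast hNge)
    rw [div_le_iff₀ hε] at h1
    linarith
  calc LS i ≤ ENNReal.ofReal 1 / N := by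
        rw [ENNReal.le_div_iff_mul_le (Or.inl (by exact_mod_cast hNpos.ne')) (Or.inl (ENNReal.natCast_ne_top N)),
          mul_comm]
        exact hNLS
    _ ≤ ENNReal.ofReal ε := by
        rw [← ENNReal.ofReal_natCast, ← ENNReal.ofReal_div_of_pos (by exact_mod_cast hNpos)]
        refine ENNReal.ofReal_le_ofReal ?_
        rw [div_le_iff₀ (by exact_mod_cast hNpos)]
        exact hNε

end Summit.AtomisticToContinuum.BoseEinsteinCondensation.Theorems.SquareSummableInfluence

end
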